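import Mathlib
import HarnessLib
import Summits.HubbardSuperconductivity.HubbardSuperconductivity.Theorems.KLProgrammeKLRegimeCountertermJacksonConvolution
import Literature.Analysis.FluidPDE.FanPartitionCalculus

/-!
# Route `KLProgramme`, crux K3 — the MIXED Jackson–Bernstein bound, abstract kernel form (MS-A34-ter (K2), part 2)

Seat hubbard-kl-k3c3-p1 (g4).  For a product convolution `J = convInt (k₀) (k₀) h` on `EuclideanSpace ℝ (Fin 2)` with a smooth `2π`-periodic kernel
family `kd a` (`kd (a+1) = (kd a)′`) and a `2π`-lattice-periodic `h` with continuous first partials `h₀, h₁`: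

* `iteratedFDeriv_convInt_apply_eucl` — the iterated Fréchet derivative on coordinate directions is the convolution with DIFFERENTIATED kernels:
  `Dⁿ J y (e_{r 0}, …, e_{r (n−1)}) = convInt (kd #₀r) (kd #₁r) h y` (`#ᵢ r` = number of `i`'s in `r`), by induction on `n` through
  `iteratedFDeriv_succ_apply_left`, `fderiv_continuousMultilinear_apply_const_apply`, and the axis derivatives `hasDerivAt_convInt_fst/snd`
  (uniqueness of derivatives along the coordinate path);
* `abs_iteratedFDeriv_convInt_apply_eucl_le` — trading ONE kernel derivative for a derivative of `h` (`convInt_deriv_fst/snd`) and the sup bound: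
  `|Dⁿ J y (e∘r)| ≤ Λ·B` whenever `(∫|kd a|)(∫|kd b|) ≤ Λ` for all `a + b + 1 = n` and `|h₀|, |h₁| ≤ B` (`n ≥ 1`);
* `norm_le_of_apply_eucl` — a continuous multilinear form on `(ℝ²)ⁿ` is bounded by `2ⁿ` times its values on coordinate tuples;
* **`norm_iteratedFDeriv_convInt_le`** — hence `‖Dⁿ J y‖ ≤ 2ⁿ·Λ·B`: with the Jackson kernel (`∫|J̃_d^{(a)}| ≲ (d+1)^a`, `…JacksonKernelDerivs`) this
  is `‖Dⁿ(𝒥_d h)‖ ≲ (d+1)^{n−1}·sup|∇h|` — the bound the low-part totals `Λ₃, Λ₄` of `…TwoLegSizesMSWithPiecesL` need.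

Pure real analysis; nothing about the model.
-/

noncomputable section

namespace Summit.HubbardSuperconductivity.HubbardSuperconductivity.Theorems.KLRegimeSplit

set_option linter.dupNamespace false -- summit = problem name (single-conjunct summit), D-0017

open Real MeasureTheory intervalIntegral Finset

/-! ## §1 Multilinear forms on `(ℝ²)ⁿ`: norm from coordinate values -/

/-- Expansion in the standard basis. -/
theorem eq_sum_smul_eucl (v : EuclideanSpace ℝ (Fin 2)) : v = ∑ i, v i • eucl i := by
  have h := (EuclideanSpace.basisFun (Fin 2) ℝ).sum_repr v
  simp only [EuclideanSpace.basisFun_repr, EuclideanSpace.basisFun_apply] at h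
  exact h.symm

/-- **A continuous multilinear form on `(ℝ²)ⁿ` is bounded by `2ⁿ` times its values on coordinate tuples.** -/
theorem norm_le_of_apply_eucl {n : ℕ} (M : ContinuousMultilinearMap ℝ (fun _ : Fin n => EuclideanSpace ℝ (Fin 2)) ℝ) {B : ℝ}
    (hB : ∀ r : Fin n → Fin 2, |M (fun k => eucl (r k))| ≤ B) : ‖M‖ ≤ 2 ^ n * B := by
  classical
  have hB0 : 0 ≤ B := (abs_nonneg _).trans (hB fun _ => 0)
  refine ContinuousMultilinearMap.opNorm_le_bound (by positivity) fun m => ?_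
  -- expand every argument in the basis
  have hm : m = fun k => ∑ i, (m k) i • eucl i := funext fun k => eq_sum_smul_eucl (m k)
  have hexp : M m = ∑ r : Fin n → Fin 2, M (fun k => (m k) (r k) • eucl (r k)) := by
    conv_lhs => rw [hm]
    rw [ContinuousMultilinearMap.map_sum]
  rw [hexp]
  calc ‖∑ r : Fin n → Fin 2, M (fun k => (m k) (r k) • eucl (r k))‖
      ≤ ∑ r : Fin n → Fin 2, ‖M (fun k => (m k) (r k) • eucl (r k))‖ := norm_sum_le _ _
    _ ≤ ∑ _r : Fin n → Fin 2, B * ∏ k, ‖m k‖ := Finset.sum_le_sum fun r _ => ?_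
    _ = 2 ^ n * B * ∏ k, ‖m k‖ := by
        rw [Finset.sum_const, Finset.card_univ, Fintype.card_fun, Fintype.card_fin, Fintype.card_fin, nsmul_eq_mul]
        push_cast; ring
  rw [ContinuousMultilinearMap.map_smul_univ, norm_smul, Real.norm_eq_abs, mul_comm]
  refine mul_le_mul (hB r) ?_ (abs_nonneg _) hB0
  rw [Finset.abs_prod]
  exact Finset.prod_le_prod (fun k _ => abs_nonneg _) fun k _ => Literature.Analysis.FluidPDE.FanPartition.abs_apply_le_norm (m k) (r k)

/-! ## §2 Iterated derivatives of the convolution form on coordinate directions -/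

/-- The number of occurrences of the index `i` in a tuple `r`. -/
def cnt {n : ℕ} (i : Fin 2) (r : Fin n → Fin 2) : ℕ := ∑ k, if r k = i then 1 else 0

/-- `cnt` on the empty tuple. -/
theorem cnt_zero (i : Fin 2) (r : Fin 0 → Fin 2) : cnt i r = 0 := by simp [cnt]

/-- `cnt` splits off the head. -/
theorem cnt_succ {n : ℕ} (i : Fin 2) (r : Fin (n + 1) → Fin 2) : cnt i r = (if r 0 = i then 1 else 0) + cnt i (Fin.tail r) := by
  unfold cnt
  rw [Fin.sum_univ_succ]
  rfl

section Kernel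

variable {kd : ℕ → ℝ → ℝ} (hkd : ∀ a s, HasDerivAt (kd a) (kd (a + 1) s) s) (hkc : ∀ a, Continuous (kd a))
  (hkp : ∀ a, Function.Periodic (kd a) (2 * π))
  {h : (Fin 2 → ℝ) → ℝ} (hh : Continuous h) (hper : ∀ (p : Fin 2 → ℝ) (z : Fin 2 → ℤ), h (fun i => p i + z i * (2 * π)) = h p)

/-- The coordinate path `τ ↦ y + τ • eᵢ` has derivative `eᵢ`. -/
theorem hasDerivAt_coord_path (y : EuclideanSpace ℝ (Fin 2)) (i : Fin 2) :
    HasDerivAt (fun τ : ℝ => y + τ • eucl i) (eucl i) (0 : ℝ) := by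
  have h := ((hasDerivAt_id (0 : ℝ)).smul_const (eucl i)).const_add y
  simpa using h

include hkd hkc hh in
/-- **Axis derivative of the convolution form** (Fréchet version): if `convInt (kd a) (kd b) h` is differentiable at `y`, its derivative along `e₀`
is `convInt (kd (a+1)) (kd b) h y` and along `e₁` it is `convInt (kd a) (kd (b+1)) h y`. -/
theorem fderiv_convInt_eucl {a b : ℕ} {y : EuclideanSpace ℝ (Fin 2)} (hd : DifferentiableAt ℝ (convInt (kd a) (kd b) h) y) (i : Fin 2) :
    fderiv ℝ (convInt (kd a) (kd b) h) y (eucl i) =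
      if i = 0 then convInt (kd (a + 1)) (kd b) h y else convInt (kd a) (kd (b + 1)) h y := by
  -- the derivative along the coordinate path, computed two ways
  have h1 : HasDerivAt (fun τ : ℝ => convInt (kd a) (kd b) h (y + τ • eucl i)) (fderiv ℝ (convInt (kd a) (kd b) h) y (eucl i)) 0 := by
    have hc := hd.hasFDerivAt.comp_hasDerivAt_of_eq (0 : ℝ) (hasDerivAt_coord_path y i) (by simp)
    simpa [Function.comp_def] using hc
  fin_cases i
  · have h2 := hasDerivAt_convInt_fst (ψ := kd b) (h := h) (hkd a) (hkc a) (hkc (a + 1)) (hkc b) hh y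
    simpa using h1.unique h2
  · have h2 := hasDerivAt_convInt_snd (φ := kd a) (h := h) (hkd b) (hkc b) (hkc (b + 1)) (hkc a) hh y
    simpa using h1.unique h2

include hkd hkc hh in
/-- **ITERATED DERIVATIVES ON COORDINATE DIRECTIONS ARE CONVOLUTIONS WITH DIFFERENTIATED KERNELS.**  For `J = convInt (kd 0) (kd 0) h` of class
`C^N` and `n ≤ N`: `Dⁿ J y (e_{r 0}, …, e_{r (n−1)}) = convInt (kd #₀r) (kd #₁r) h y`. -/
theorem iteratedFDeriv_convInt_apply_eucl {N : ℕ} (hJ : ContDiff ℝ N (convInt (kd 0) (kd 0) h)) :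
    ∀ n : ℕ, n ≤ N → ∀ (r : Fin n → Fin 2) (y : EuclideanSpace ℝ (Fin 2)),
      iteratedFDeriv ℝ n (convInt (kd 0) (kd 0) h) y (fun k => eucl (r k)) = convInt (kd (cnt 0 r)) (kd (cnt 1 r)) h y := by
  intro n
  induction n with
  | zero =>
    intro _ r y
    simp [cnt_zero]
  | succ n ih =>
    intro hn r y
    have hn' : n ≤ N := by omega
    have hlt : (n : WithTop ℕ∞) < N := by exact_mod_cast (show n < N by omega)
    -- differentiability of `Dⁿ J`
    have hdiffn : Differentiable ℝ (iteratedFDeriv ℝ n (convInt (kd 0) (kd 0) h)) := hJ.differentiable_iteratedFDeriv hlt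
    rw [iteratedFDeriv_succ_apply_left]
    -- evaluate the tail first (apply-commutation), then use the induction hypothesis as a function identity
    have htail : (fun k : Fin n => eucl (Fin.tail r k)) = Fin.tail (fun k : Fin (n + 1) => eucl (r k)) := by
      funext k; simp [Fin.tail]
    have hfun : (fun z => iteratedFDeriv ℝ n (convInt (kd 0) (kd 0) h) z (Fin.tail fun k => eucl (r k))) =
        convInt (kd (cnt 0 (Fin.tail r))) (kd (cnt 1 (Fin.tail r))) h := by
      funext z; rw [← htail]; exact ih hn' (Fin.tail r) z
    have hd' : DifferentiableAt ℝ (convInt (kd (cnt 0 (Fin.tail r))) (kd (cnt 1 (Fin.tail r))) h) y := by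
      rw [← hfun]; exact (hdiffn y).continuousMultilinear_apply_const _
    rw [← fderiv_continuousMultilinear_apply_const_apply (hdiffn y), hfun, fderiv_convInt_eucl hkd hkc hh hd', cnt_succ, cnt_succ]
    by_cases h0 : r 0 = 0
    · simp [h0, Nat.add_comm]
    · have h1 : r 0 = 1 := by omega
      simp [h1, Nat.add_comm]

include hkd hkc hkp hh hper in
/-- **The mixed bound on coordinate directions**: trade one kernel derivative for a derivative of `h`, then the sup bound.  For `n ≥ 1`,
`|Dⁿ J y (e∘r)| ≤ Λ·B` whenever `(∫|kd a|)(∫|kd b|) ≤ Λ` for all `a + b + 1 = n` and the first partials `h₀, h₁` of `h` are bounded by `B`. -/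
theorem abs_iteratedFDeriv_convInt_apply_eucl_le {N : ℕ} (hJ : ContDiff ℝ N (convInt (kd 0) (kd 0) h))
    {h₀ h₁ : (Fin 2 → ℝ) → ℝ} (hh₀ : Continuous h₀) (hh₁ : Continuous h₁)
    (hder₀ : ∀ s t, HasDerivAt (fun u => h ![u, t]) (h₀ ![s, t]) s) (hder₁ : ∀ s t, HasDerivAt (fun u => h ![s, u]) (h₁ ![s, t]) t)
    {B : ℝ} (hB₀ : ∀ p, |h₀ p| ≤ B) (hB₁ : ∀ p, |h₁ p| ≤ B)
    {n : ℕ} (hn1 : 1 ≤ n) (hn : n ≤ N) {Λ : ℝ}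
    (hΛ : ∀ a b, a + b + 1 = n → (∫ s in (-π)..π, |kd a s|) * (∫ s in (-π)..π, |kd b s|) ≤ Λ)
    (r : Fin n → Fin 2) (y : EuclideanSpace ℝ (Fin 2)) :
    |iteratedFDeriv ℝ n (convInt (kd 0) (kd 0) h) y (fun k => eucl (r k))| ≤ Λ * B := by
  have hB : 0 ≤ B := (abs_nonneg _).trans (hB₀ 0)
  rw [iteratedFDeriv_convInt_apply_eucl hkd hkc hh hJ n hn r y]
  -- `cnt 0 r + cnt 1 r = n`
  have hsum : cnt 0 r + cnt 1 r = n := by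
    unfold cnt
    rw [← Finset.sum_add_distrib]
    have : ∀ k, ((if r k = 0 then 1 else 0) + (if r k = 1 then 1 else 0) : ℕ) = 1 := fun k => by
      have := (r k).isLt; rcases Nat.lt_or_ge (r k : ℕ) 1 with h | h
      · have : r k = 0 := Fin.ext (by omega)
        simp [this]
      · have : r k = 1 := Fin.ext (by omega)
        simp [this]
    simp [this]
  rcases Nat.eq_zero_or_pos (cnt 0 r) with h0 | h0
  · -- all directions are `e₁`: trade on the second factor
    have hb : 1 ≤ cnt 1 r := by omega
    obtain ⟨b, hb'⟩ : ∃ b, cnt 1 r = b + 1 := ⟨cnt 1 r - 1, by omega⟩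
    rw [h0, hb', convInt_deriv_snd (φ := kd 0) (hkd b) (hkc (b + 1)) (hkp b) hh₁ hder₁ hper y]
    refine (abs_convInt_le (hkc 0) (hkc b) (hkp 0) (hkp b) hh₁ hB₁ y).trans ?_
    rw [← mul_assoc]
    exact mul_le_mul_of_nonneg_right (hΛ 0 b (by omega)) hB
  · obtain ⟨a, ha'⟩ : ∃ a, cnt 0 r = a + 1 := ⟨cnt 0 r - 1, by omega⟩
    rw [ha', convInt_deriv_fst (ψ := kd (cnt 1 r)) (hkd a) (hkc (a + 1)) (hkp a) (hkc _) hh hh₀ hder₀ hper y]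
    refine (abs_convInt_le (hkc a) (hkc _) (hkp a) (hkp _) hh₀ hB₀ y).trans ?_
    rw [← mul_assoc]
    exact mul_le_mul_of_nonneg_right (hΛ a (cnt 1 r) (by omega)) hB

include hkd hkc hkp hh hper in
/-- **THE MIXED JACKSON–BERNSTEIN BOUND, abstract kernel form**: `‖Dⁿ J y‖ ≤ 2ⁿ·Λ·B` under the hypotheses of
`abs_iteratedFDeriv_convInt_apply_eucl_le`. -/
theorem norm_iteratedFDeriv_convInt_le {N : ℕ} (hJ : ContDiff ℝ N (convInt (kd 0) (kd 0) h))
    {h₀ h₁ : (Fin 2 → ℝ) → ℝ} (hh₀ : Continuous h₀) (hh₁ : Continuous h₁)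
    (hder₀ : ∀ s t, HasDerivAt (fun u => h ![u, t]) (h₀ ![s, t]) s) (hder₁ : ∀ s t, HasDerivAt (fun u => h ![s, u]) (h₁ ![s, t]) t)
    {B : ℝ} (hB₀ : ∀ p, |h₀ p| ≤ B) (hB₁ : ∀ p, |h₁ p| ≤ B)
    {n : ℕ} (hn1 : 1 ≤ n) (hn : n ≤ N) {Λ : ℝ}
    (hΛ : ∀ a b, a + b + 1 = n → (∫ s in (-π)..π, |kd a s|) * (∫ s in (-π)..π, |kd b s|) ≤ Λ)
    (y : EuclideanSpace ℝ (Fin 2)) :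
    ‖iteratedFDeriv ℝ n (convInt (kd 0) (kd 0) h) y‖ ≤ 2 ^ n * (Λ * B) :=
  norm_le_of_apply_eucl _ fun r =>
    abs_iteratedFDeriv_convInt_apply_eucl_le hkd hkc hkp hh hper hJ hh₀ hh₁ hder₀ hder₁ hB₀ hB₁ hn1 hn hΛ r y

end Kernel

end Summit.HubbardSuperconductivity.HubbardSuperconductivity.Theorems.KLRegimeSplit

end
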